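import Summits.CriticalPhenomena.PercolationContinuityZ3.Theorems.SahiMasterFamilyStrictHierarchyBelow

/-!
# Sahi's positivity hierarchy is STRICT AT EVERY ORDER: for each `w ≥ 2` a probability law, positive of all orders `< w`,
# that fails at order `w`

Support file of the master-family programme (crux `NoHeavyLowerTail`, stmt-CriticalPhenomena-4575; cell `prim-masterthm`,
seat P4 "induction on `k` through the FKG-lattice structure", unit `prim-masterthm-p4-g4`).  Vocabulary: `SahiPositive μ n`
(Sahi's class `C_n`: `E_n ≥ 0` on nonnegative monotone families [Sahi2008, Conj. 5; LiebSahi2021, Conj. 1.1]), the poset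
`PW w = {⊥ < m_1,…,m_w < ⊤}` and its light law `muW` (`SahiMasterFamilyStrictHierarchyPoset`), the light-atom expansion of `E_n`
(`SahiMasterFamilyLightAtoms*`), the pair functional (`SahiMasterFamilyStrictHierarchyPairs`).

THEOREM (`sahiPositive_lawW_of_lt`, `not_sahiPositive_lawW`, `exists_sahiPositive_below_not_at`).  For every `w ≥ 2` the law
`μ_w = β δ_⊥ + ε Σ_j δ_{m_j} + t δ_⊤` on `P_w`, with `ε = 1/(8(w+2)^{w+4})`, `t = ε²(C(w,2) − ½)`, is Sahi-positive of every order
`k < w` and NOT of order `w`: `E_w(1_{U_1},…,1_{U_w}) < 0` for `U_i = {⊤} ∪ {m_j : j ≠ i}`.  So Sahi's classes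
`𝒞_1 ⊋ 𝒞_2 ⊋ 𝒞_3 ⊋ ⋯` are strictly nested at EVERY order (order 2→3: [Kahn2022, Cor. 4]; 3→4: `SahiMasterFamilyC3NotC4`; all
orders: new), and — with `SahiMasterFamilyWidthCollapse` (orders `≤ max(width,2)` give all orders) and `PW.exists_le_of_fin_succ`
(`P_w` has width `w`) — the width bound is SHARP for every width (`exists_width_sharp`).  Cube form: `exists_cube_sahiPositive_below_not_at`
(the law `β δ_∅ + ε Σ δ_{{j}} + t δ_{[w]}` on `2^{[w]}`, violating family "some coordinate other than `i` is on").

PROOF (seat file PROOF-STRICTNESS.md).  In the light-atom expansion `S₁ − S₂ − T ≤ E_{n+1} ≤ S₁ − S₂ + T` (`T ≤ (w+2)^{n+1} ε³ (n+1)!`):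
(a) for the violating family `S₁ = ffm t (w−1) ≤ t (w−1)!` while `S₂ ≥ (1−(w−1)ε) ε² C(w,2) (w−1)!` (every one of the `C(w,2)` pairs
of co-singleton columns contributes `(w−1)!`, `SahiPairFunctional.sum_offDiag_rpairSum_erase`), so `E_w ≤ ε²(w−1)!(−½ + O(ε)) < 0`;
(b) for `n+1 < w` proper up-sets with no atom common to all, `S₁ = ffm t n ≥ t n!(1 − nt)` and `S₂ ≤ ε²(C(w,2) − 1) n! + O(ε³)` by the
PIGEONHOLE heart `SahiPairFunctional.sum_offDiag_rpairSum_le`, so `E ≥ ε² n! (½ − O(ε)) > 0`; (c) with a common atom `S₁ ≥ ε n!(1 − nε)`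
dominates.  Members `∅`/`univ` are handled by `E = 0` / branching, and the orders `< w` by induction.
HONEST FRAMING: a theorem about GENERAL probability weights on finite posets; it says nothing about `C_n` for FKG or product
measures [Sahi2008, Conj. 5; Kahn2022, Conj. 5], which remain open.  [this work]
-/

namespace Summit.CriticalPhenomena.PercolationContinuityZ3.Theorems

namespace SahiStrictHierarchy

open Finset Function
open Literature.Combinatorics.Sahi2008 SahiRepresentativeForm SahiPairFunctional SahiLightAtoms PW

variable {w : ℕ}

/-! ### (a) the violating family at order `w = n + 1` -/

/-- The rows of the violating family: column `j` misses exactly row `j`. [this work] -/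
theorem rows_bad_mid {n : ℕ} (j : Fin (n + 1)) :
    rows (fun i : Fin (n + 1) => (bad i : Finset (PW (n + 1)))) (mid j) = univ.erase j := by
  ext i
  rw [mem_rows, mem_bad_iff_of_mid, mem_erase]
  simp only [mem_univ, and_true, ne_eq]
  exact ⟨fun h e => h e.symm, fun h e => h e.symm⟩

/-- **Case (a).** `E_{n+1}(1_{U_0},…,1_{U_n}) < 0` for the violating family on `P_{n+1}`. [this work] -/
theorem sahiE_bad_neg {n : ℕ} (hw : 2 ≤ n + 1) :
    sahiE (lawW (n + 1)) (n + 1) (fun i => setInd (bad i : Finset (PW (n + 1)))) < 0 := by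
  have hε := (epsW_pos (n + 1))
  have hε1 := (epsW_le_one (n + 1))
  have ht := topW_bounds hw
  have hW := (two_le_W (n + 1))
  have hQ := QW_le (n + 1)
  set U : Fin (n + 1) → Finset (PW (n + 1)) := fun i => bad i with hUdef
  have hU : ∀ i, IsUpperSet ((U i : Finset (PW (n + 1))) : Set (PW (n + 1))) := fun i => isUpperSet_bad _
  have hprop : ∀ i, U i ≠ univ := fun i => bad_ne_univ _
  have hne : ∀ i, (U i).Nonempty := fun i => ⟨top, top_mem_bad _⟩
  have hl : ∀ i, ∀ a ∈ U i, 0 ≤ lawW (n + 1) a ∧ lawW (n + 1) a ≤ epsW (n + 1) :=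
    fun i => lawW_light hw (hU i) (hprop i)
  set ε := epsW (n + 1) with hεdef
  set t := topW (n + 1) with htdef
  set Q := QW (n + 1) with hQdef
  set W : ℝ := ((n + 1 : ℕ) : ℝ) + 2 with hWdef
  set F : ℝ := (n.factorial : ℝ) with hFdef
  have hF : 0 < F := by rw [hFdef]; exact_mod_cast Nat.factorial_pos n
  have htQ : t = ε ^ 2 * (Q - 1 / 2) := rfl
  have hle := sahiE_setInd_le (lawW (n + 1)) n U hε.le hε1 hl
  -- first order: the constant system at `⊤` only
  have hS1 : sumOne (lawW (n + 1)) U ≤ t * F := by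
    rw [sumOne_eq]
    have hcommon : univ.filter (fun a => ∀ i, a ∈ U i) = {top} := by
      ext a
      rw [mem_common_iff U hU hprop hne, mem_singleton]
      constructor
      · rintro (h | ⟨j, rfl, hj⟩)
        · exact h
        · have := hj j
          rw [hUdef, mem_bad_iff_of_mid] at this
          exact absurd rfl this
      · exact Or.inl
    rw [hcommon, sum_singleton]
    have := ffm_le ht.1.le (ht.2.2.trans hε1) n
    simpa [lawW, muW] using this
  -- `n ε ≤ 1`
  have hnW : (n : ℝ) + 1 ≤ W := by rw [hWdef]; push_cast; linarith
  have hnε : (n : ℝ) * ε ≤ 1 := by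
    have h := eps_mul_le (w := n + 1) (X := n) (by
      have h1 := (W_pow_le_pow (w := n + 1) (show 1 ≤ n + 1 + 3 by omega))
      rw [pow_one] at h1
      have h0 : (0:ℝ) ≤ (((n + 1 : ℕ) : ℝ) + 2) ^ (n + 1 + 3) := by positivity
      linarith)
    linarith [mul_comm (n : ℝ) ε]
  -- second order from below: all pairs of distinct co-singleton columns contribute `n!`
  have hbad : 2 * ∑ q ∈ (univ : Finset (Fin (n + 1))).offDiag,
      (rpairSum (rows U (mid q.1)) (rows U (mid q.2)) : ℝ) = (((n : ℝ) + 1) * (n + 1) - (n + 1)) * F := by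
    have hrows : ∀ j, rows U (mid j) = univ.erase j := fun j => rows_bad_mid j
    simp only [hrows]
    have e := congrArg (Nat.cast : ℕ → ℝ) (sum_offDiag_rpairSum_erase (n := n))
    push_cast [Nat.cast_sub (Nat.le_mul_self (n + 1))] at e
    rw [hFdef]
    linarith
  have hS2 : (1 - n * ε) * (ε ^ 2 * (Q * F)) ≤ sumTwo (lawW (n + 1)) U := by
    refine le_trans ?_ (le_sumTwo (lawW (n + 1)) U hε1 hnε hl)
    refine mul_le_mul_of_nonneg_left ?_ (by linarith)
    rw [pairTotal_eq U hU hprop]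
    have hQF : ε ^ 2 * (Q * F) = ε ^ 2 * ∑ q ∈ (univ : Finset (Fin (n + 1))).offDiag,
        (rpairSum (rows U (mid q.1)) (rows U (mid q.2)) : ℝ) := by
      have : Q * F = (((n : ℝ) + 1) * (n + 1) - (n + 1)) * F / 2 := by
        rw [hQdef]; unfold QW; push_cast; ring
      rw [this, ← hbad]; ring
    rw [hQF]
    have : 0 ≤ t * ε * ∑ j : Fin (n + 1), ((rpairSum (rows U top) (rows U (mid j)) : ℝ) +
        rpairSum (rows U (mid j)) (rows U top)) :=
      mul_nonneg (mul_nonneg ht.1.le hε.le) (sum_nonneg fun j _ => by positivity)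
    linarith
  have hT : ((Fintype.piFinset U).card : ℝ) * (ε ^ 3 * (n + 1).factorial) ≤
      ε ^ 3 * (W ^ (n + 1) * ((n : ℝ) + 1)) * F := tail_le U
  -- numerical heart: `ε (n Q + (n+1) W^{n+1}) ≤ 3/16`
  have hZ : ε * ((n : ℝ) * Q + W ^ (n + 1) * ((n : ℝ) + 1)) ≤ 3 / 16 := by
    refine eps_mul_le ?_
    have hn0 : (0 : ℝ) ≤ n := Nat.cast_nonneg _
    have h1 : (n : ℝ) * Q ≤ W ^ (n + 1 + 3) := by
      calc (n : ℝ) * Q ≤ W * W ^ 2 := mul_le_mul (by linarith) hQ.2 hQ.1 (by positivity)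
        _ = W ^ 3 := by ring
        _ ≤ W ^ (n + 1 + 3) := (W_pow_le_pow (by omega))
    have h3 : W ^ (n + 1) * ((n : ℝ) + 1) ≤ W ^ (n + 1 + 3) := by
      calc W ^ (n + 1) * ((n : ℝ) + 1) ≤ W ^ (n + 1) * W := mul_le_mul_of_nonneg_left hnW (by positivity)
        _ = W ^ (n + 2) := by ring
        _ ≤ W ^ (n + 1 + 3) := (W_pow_le_pow (by omega))
    have h0 : (0 : ℝ) ≤ W ^ (n + 1 + 3) := by positivity
    linarith
  -- assemble: `E ≤ F ε² (−1/2 + ε Z) < 0`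
  have key : sumOne (lawW (n + 1)) U - sumTwo (lawW (n + 1)) U +
      (Fintype.piFinset U).card * (ε ^ 3 * (n + 1).factorial) ≤
      F * (ε ^ 2 * (-(1 / 2) + ε * ((n : ℝ) * Q + W ^ (n + 1) * ((n : ℝ) + 1)))) := by
    have e1 : t * F - (1 - n * ε) * (ε ^ 2 * (Q * F)) + ε ^ 3 * (W ^ (n + 1) * ((n : ℝ) + 1)) * F =
        F * (ε ^ 2 * (-(1 / 2) + ε * ((n : ℝ) * Q + W ^ (n + 1) * ((n : ℝ) + 1)))) := by
      rw [htQ]; ring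
    linarith
  have hneg : F * (ε ^ 2 * (-(1 / 2) + ε * ((n : ℝ) * Q + W ^ (n + 1) * ((n : ℝ) + 1)))) < 0 := by
    have : -(1 / 2) + ε * ((n : ℝ) * Q + W ^ (n + 1) * ((n : ℝ) + 1)) < 0 := by linarith
    exact mul_neg_of_pos_of_neg hF (mul_neg_of_pos_of_neg (pow_pos hε 2) this)
  linarith

/-! ### The theorem -/

/-- All orders `n + 1 < w` on indicator families of up-sets, by induction on `n` (members `∅`: `E = 0`; members `univ`:
branching; otherwise cases (b)/(c)). [this work] -/
theorem sahiE_setInd_nonneg_of_lt (hw : 2 ≤ w) : ∀ n : ℕ, n + 1 < w → ∀ U : Fin (n + 1) → Finset (PW w),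
    (∀ i, IsUpperSet ((U i : Finset (PW w)) : Set (PW w))) → 0 ≤ sahiE (lawW w) (n + 1) (fun i => setInd (U i)) := by
  intro n
  induction n with
  | zero =>
    intro _ U _
    rw [sahiE_one_apply]
    exact ex_nonneg (lawW_nonneg hw) fun x => setInd_nonneg _ _
  | succ n ih =>
    intro hn U hU
    by_cases h0 : ∃ i, U i = ∅
    · obtain ⟨i, hi⟩ := h0
      exact (sahiE_setInd_eq_zero_of_empty (lawW w) (n + 1) U hi).symm.le
    by_cases h1 : ∃ i, U i = univ
    · obtain ⟨i, hi⟩ := h1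
      rw [sahiE_setInd_of_mem_univ (sum_lawW w) U hi]
      exact mul_nonneg (Nat.cast_nonneg _) (ih (by omega) _ fun j => hU _)
    push Not at h0 h1
    have hne : ∀ i, (U i).Nonempty := h0
    by_cases h2 : ∃ j, ∀ i, mid j ∈ U i
    · obtain ⟨j, hj⟩ := h2
      exact sahiE_nonneg_of_common_mid hw (by omega) U hU h1 hj
    · push Not at h2
      exact sahiE_nonneg_of_no_common_mid hw (by omega) U hU h1 hne h2

/-- **Positive below `w`**: `μ_w` is Sahi-positive of every order `k < w`. [this work] -/
theorem sahiPositive_lawW_of_lt (hw : 2 ≤ w) {k : ℕ} (hk : k < w) : SahiPositive (lawW w) k := by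
  cases k with
  | zero => exact sahiPositive_zero _
  | succ n =>
    rw [sahiPositive_iff_indicators]
    exact fun U hU => sahiE_setInd_nonneg_of_lt hw n hk U hU

/-- **Not positive at `w`**: `E_w(1_{U_1},…,1_{U_w}) < 0` for `U_i = {⊤} ∪ {m_j : j ≠ i}`. [this work] -/
theorem not_sahiPositive_lawW (hw : 2 ≤ w) : ¬ SahiPositive (lawW w) w := by
  obtain ⟨n, rfl⟩ : ∃ n, w = n + 1 := ⟨w - 1, by omega⟩
  intro h
  have hneg := sahiE_bad_neg hw
  have hpos : 0 ≤ sahiE (lawW (n + 1)) (n + 1) (fun i => setInd (bad i : Finset (PW (n + 1)))) :=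
    h _ (fun i x => setInd_nonneg _ _) (fun i => monotone_setInd (isUpperSet_bad _))
  linarith

/-- **Sahi's hierarchy is strict at every order.**  For every `w ≥ 2` there is a probability weight on the finite poset
`P_w` (of width `w`: among any `w+1` points two are comparable) that is Sahi-positive of every order `< w` and not of
order `w`. [this work] -/
theorem exists_sahiPositive_below_not_at (w : ℕ) (hw : 2 ≤ w) :
    ∃ μ : PW w → ℝ, (∀ x, 0 ≤ μ x) ∧ ∑ x, μ x = 1 ∧
      (∀ y : Fin (w + 1) → PW w, ∃ i j, i ≠ j ∧ y i ≤ y j) ∧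
      (∀ k < w, SahiPositive μ k) ∧ ¬ SahiPositive μ w :=
  ⟨lawW w, lawW_nonneg hw, sum_lawW w, PW.exists_le_of_fin_succ (by omega),
    fun _ hk => sahiPositive_lawW_of_lt hw hk, not_sahiPositive_lawW hw⟩

/-- **Cube form.** On the Boolean lattice `2^{[w]}` (`w ≥ 2`) the law `β δ_∅ + ε Σ_j δ_{{j}} + t δ_{[w]}` (the push-forward of
`μ_w` along `⊥ ↦ ∅, m_j ↦ {j}, ⊤ ↦ [w]`) is Sahi-positive of every order `< w` and not of order `w`; the violating family is
`U_i = {S : S ⊄ {i}}` ("some coordinate other than `i` is on"). [this work] -/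
theorem exists_cube_sahiPositive_below_not_at (w : ℕ) (hw : 2 ≤ w) :
    ∃ ν : Finset (Fin w) → ℝ, (∀ x, 0 ≤ ν x) ∧ ∑ x, ν x = 1 ∧ (∀ k < w, SahiPositive ν k) ∧ ¬ SahiPositive ν w := by
  refine ⟨pushWeight (lawW w) toCube, fun x => pushWeight_nonneg (lawW_nonneg hw) _ _,
    by rw [sum_pushWeight, sum_lawW], fun k hk => (sahiPositive_lawW_of_lt hw hk).of_pushWeight toCube_monotone, ?_⟩
  obtain ⟨n, rfl⟩ : ∃ n, w = n + 1 := ⟨w - 1, by omega⟩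
  intro h
  have hpos : 0 ≤ sahiE (pushWeight (lawW (n + 1)) toCube) (n + 1)
      (fun i => setInd (orSet i : Finset (Finset (Fin (n + 1))))) :=
    h _ (fun i x => setInd_nonneg _ _) (fun i => monotone_setInd (isUpperSet_orSet _))
  rw [sahiE_pushWeight] at hpos
  have heq : (fun i : Fin (n + 1) => setInd (orSet i : Finset (Finset (Fin (n + 1)))) ∘ toCube) =
      fun i => setInd (bad i : Finset (PW (n + 1))) := by
    funext i
    exact setInd_orSet_comp_toCube hw _
  rw [heq] at hpos
  linarith [sahiE_bad_neg hw]

end SahiStrictHierarchy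

end Summit.CriticalPhenomena.PercolationContinuityZ3.Theorems
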